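import Mathlib
import Summits.Ventures.PercRepro2.CoinChainLayerCakeAbstract
import Summits.Ventures.PercRepro2.CoinChainWorld1
import Summits.Ventures.PercRepro2.CoinChainStar

/-!
# The AND-switch chain by the coin-RESOLVED layer cake
(blind cell PercRepro2, night-2 g21; proofs/NIGHT2-DARC.md §61)

The chain functional `T(R_ρ, G_ρ)` (κ-integrated `R`-law `ν · chainMix ent ent' ρ c d`, gate
`ν · chainMix ent ent' ρ c d'`) is linear in the gate, and `chainMix_affine` writes the gate as
`(1 − ρ) · G⁰ + ρ · G¹` — the coin-closed gate `G⁰ = ν · chainMix 0 c d'` and the coin-open gate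
`G¹ = ν · chainMix 1 c d'`.  `twoGate_functional_nonneg` applies with the entry set `ent ∪ ent'`:
`R_ρ`, `G⁰`, `G¹` are log-supermodular (`mixture_lsm`), `G¹` is Holley-above `R_ρ` from every
entered cluster (`chain_cross_holley`, exactly as in `chain_world1_nonneg`), and all three agree
on the clusters missing `ent ∪ ent'` (`chainMix_of_not_meet`).  THEOREM
`chain_functional_nonneg_of_layerCake`: the chain functional is `≥ 0` for every `ρ ∈ [0, 1]` and
all nonnegative increasing markers whenever the gate lowers the `x`-mean (`hSx`) and the
coin-closed gate has `x`-mean above the chain `R`-mean (`hG0x`; for the pure chain `ent = ∅`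
this says the world-0 mean is above the world-1 mean, i.e. the world shift of `x` is `≤ 0`) —
no condition on the head beyond those of `chain_world1_nonneg`, no condition on the `y`-shifts.
-/

namespace Summit.Ventures.PercRepro2.Coin

open Classical

section LayerCakeChain

variable {V : Type*} [DecidableEq V] {R : Type*} [Field R] [LinearOrder R] [IsStrictOrderedRing R]

/-- **THE AND-SWITCH CHAIN BY THE COIN-RESOLVED LAYER CAKE.** `R_ρ = ν · chainMix ent ent' ρ c d`,
gate `G_ρ = ν · chainMix ent ent' ρ c d'` (head hypotheses of `chain_world1_nonneg`; general
nonnegative increasing markers `x, y`).  If the gate LOWERS the `x`-mean (`hSx`) and the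
coin-CLOSED gate `G⁰ = ν · chainMix ent ent' 0 c d'` has `x`-mean above the chain `R`-mean
(`hG0x`), the cleared functional is nonnegative — for every `ρ ∈ [0, 1]`, with no sign condition on
the `y`-shifts. -/
theorem chain_functional_nonneg_of_layerCake (U ent ent' : Finset V) (ν c d d' : Finset V → R)
    (ρ : R) (hρ0 : 0 ≤ ρ) (hρ1 : ρ ≤ 1) (hν0 : ∀ W, 0 ≤ ν W)
    (hν : ∀ s ⊆ U, ∀ t ⊆ U, ν s * ν t ≤ ν (s ∩ t) * ν (s ∪ t))
    (hc0 : ∀ W, 0 ≤ c W) (hd0 : ∀ W, 0 ≤ d W) (hd'0 : ∀ W, 0 ≤ d' W)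
    (hdc : ∀ W, d W ≤ c W) (hd'c : ∀ W, d' W ≤ c W)
    (hcc : ∀ s t, c s * c t ≤ c (s ∩ t) * c (s ∪ t))
    (hdd : ∀ s t, d s * d t ≤ d (s ∩ t) * d (s ∪ t))
    (hd'd' : ∀ s t, d' s * d' t ≤ d' (s ∩ t) * d' (s ∪ t))
    (hcd : ∀ s t, c s * d t ≤ c (s ∩ t) * d (s ∪ t))
    (hcd' : ∀ s t, c s * d' t ≤ c (s ∩ t) * d' (s ∪ t))
    (hdd' : ∀ s t, d s * d' t ≤ d (s ∩ t) * d' (s ∪ t))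
    (hratio : ∀ s t, s ⊆ t → d s * c t ≤ c s * d t)
    (hratio' : ∀ s t, s ⊆ t → d' s * c t ≤ c s * d' t)
    (x y : Finset V → R) (hx0 : ∀ W, 0 ≤ x W) (hy0 : ∀ W, 0 ≤ y W)
    (hxm : ∀ s t, x s ≤ x (s ∪ t)) (hym : ∀ s t, y s ≤ y (s ∪ t))
    (hSx : (∑ W ∈ U.powerset, ν W * chainMix ent ent' ρ c d' W * x W) *
          (∑ W ∈ U.powerset, ν W * chainMix ent ent' ρ c d W) ≤
        (∑ W ∈ U.powerset, ν W * chainMix ent ent' ρ c d' W) *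
          (∑ W ∈ U.powerset, ν W * chainMix ent ent' ρ c d W * x W))
    (hG0x : (∑ W ∈ U.powerset, ν W * chainMix ent ent' 0 c d' W) *
          (∑ W ∈ U.powerset, ν W * chainMix ent ent' ρ c d W * x W) ≤
        (∑ W ∈ U.powerset, ν W * chainMix ent ent' 0 c d' W * x W) *
          (∑ W ∈ U.powerset, ν W * chainMix ent ent' ρ c d W)) :
    0 ≤ (∑ W ∈ U.powerset, ν W * chainMix ent ent' ρ c d W) ^ 2 *
          (∑ W ∈ U.powerset, ν W * chainMix ent ent' ρ c d' W * (x W * y W))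
        - (∑ W ∈ U.powerset, ν W * chainMix ent ent' ρ c d W) *
          (∑ W ∈ U.powerset, ν W * chainMix ent ent' ρ c d W * x W) *
          (∑ W ∈ U.powerset, ν W * chainMix ent ent' ρ c d' W * y W)
        - (∑ W ∈ U.powerset, ν W * chainMix ent ent' ρ c d W) *
          (∑ W ∈ U.powerset, ν W * chainMix ent ent' ρ c d W * y W) *
          (∑ W ∈ U.powerset, ν W * chainMix ent ent' ρ c d' W * x W)
        + (∑ W ∈ U.powerset, ν W * chainMix ent ent' ρ c d W * x W) *
          (∑ W ∈ U.powerset, ν W * chainMix ent ent' ρ c d W * y W) *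
          (∑ W ∈ U.powerset, ν W * chainMix ent ent' ρ c d' W) := by
  set G : Finset V → R := fun W => ν W * chainMix ent ent' ρ c d W with hGdef
  set G₀ : Finset V → R := fun W => ν W * chainMix ent ent' 0 c d' W with hG₀def
  set G₁ : Finset V → R := fun W => ν W * chainMix ent ent' 1 c d' W with hG₁def
  have hcomb : ∀ W, (1 - ρ) * G₀ W + ρ * G₁ W = ν W * chainMix ent ent' ρ c d' W := by
    intro W
    simp only [hG₀def, hG₁def]
    rw [chainMix_affine ent ent' ρ c d' W]; ring
  have hm0 : ∀ W, 0 ≤ chainMix ent ent' ρ c d W := chainMix_nonneg ent ent' hρ0 hρ1 hc0 hd0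
  have hm'0 : ∀ W, 0 ≤ chainMix ent ent' 0 c d' W :=
    chainMix_nonneg ent ent' (le_refl 0) (by norm_num) hc0 hd'0
  have hm'1 : ∀ W, 0 ≤ chainMix ent ent' 1 c d' W :=
    chainMix_nonneg ent ent' (by norm_num) (le_refl 1) hc0 hd'0
  have hG0 : ∀ W, 0 ≤ G W := fun W => mul_nonneg (hν0 W) (hm0 W)
  have hG₀0 : ∀ W, 0 ≤ G₀ W := fun W => mul_nonneg (hν0 W) (hm'0 W)
  have hG₁0 : ∀ W, 0 ≤ G₁ W := fun W => mul_nonneg (hν0 W) (hm'1 W)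
  have hmix := mixture_lsm ent ent' ρ hρ0 hρ1 c d hc0 hd0 hdc hcc hdd hcd hratio
  have hmix0 := mixture_lsm ent ent' 0 (le_refl 0) (by norm_num) c d' hc0 hd'0 hd'c hcc hd'd' hcd'
    hratio'
  have hmix1 := mixture_lsm ent ent' 1 (by norm_num) (le_refl 1) c d' hc0 hd'0 hd'c hcc hd'd' hcd'
    hratio'
  have wLL : ∀ s ⊆ U, ∀ t ⊆ U, G s * G t ≤ G (s ∩ t) * G (s ∪ t) := by
    intro s hs t ht
    simp only [hGdef]
    calc ν s * chainMix ent ent' ρ c d s * (ν t * chainMix ent ent' ρ c d t)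
        = (ν s * ν t) * (chainMix ent ent' ρ c d s * chainMix ent ent' ρ c d t) := by ring
      _ ≤ (ν (s ∩ t) * ν (s ∪ t)) *
            (chainMix ent ent' ρ c d (s ∩ t) * chainMix ent ent' ρ c d (s ∪ t)) :=
          mul_le_mul (hν s hs t ht) (hmix s t) (mul_nonneg (hm0 _) (hm0 _))
            (mul_nonneg (hν0 _) (hν0 _))
      _ = _ := by ring
  have w00 : ∀ s ⊆ U, ∀ t ⊆ U, G₀ s * G₀ t ≤ G₀ (s ∩ t) * G₀ (s ∪ t) := by
    intro s hs t ht
    simp only [hG₀def]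
    calc ν s * chainMix ent ent' 0 c d' s * (ν t * chainMix ent ent' 0 c d' t)
        = (ν s * ν t) * (chainMix ent ent' 0 c d' s * chainMix ent ent' 0 c d' t) := by ring
      _ ≤ (ν (s ∩ t) * ν (s ∪ t)) *
            (chainMix ent ent' 0 c d' (s ∩ t) * chainMix ent ent' 0 c d' (s ∪ t)) :=
          mul_le_mul (hν s hs t ht) (hmix0 s t) (mul_nonneg (hm'0 _) (hm'0 _))
            (mul_nonneg (hν0 _) (hν0 _))
      _ = _ := by ring
  have w11 : ∀ s ⊆ U, ∀ t ⊆ U, G₁ s * G₁ t ≤ G₁ (s ∩ t) * G₁ (s ∪ t) := by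
    intro s hs t ht
    simp only [hG₁def]
    calc ν s * chainMix ent ent' 1 c d' s * (ν t * chainMix ent ent' 1 c d' t)
        = (ν s * ν t) * (chainMix ent ent' 1 c d' s * chainMix ent ent' 1 c d' t) := by ring
      _ ≤ (ν (s ∩ t) * ν (s ∪ t)) *
            (chainMix ent ent' 1 c d' (s ∩ t) * chainMix ent ent' 1 c d' (s ∪ t)) :=
          mul_le_mul (hν s hs t ht) (hmix1 s t) (mul_nonneg (hm'1 _) (hm'1 _))
            (mul_nonneg (hν0 _) (hν0 _))
      _ = _ := by ring
  have wML : ∀ s ⊆ U, ∀ t ⊆ U, (∃ r ∈ ent ∪ ent', r ∈ s) →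
      G₁ s * G t ≤ G (s ∩ t) * G₁ (s ∪ t) := by
    intro s hs t ht hse
    have hsu : ∃ r ∈ ent ∪ ent', r ∈ s ∪ t := by
      obtain ⟨r, hr, hrs⟩ := hse; exact ⟨r, hr, Finset.mem_union_left _ hrs⟩
    simp only [hGdef, hG₁def]
    rw [chainMix_one_of_meet ent ent' c d' hse, chainMix_one_of_meet ent ent' c d' hsu]
    calc ν s * d' s * (ν t * chainMix ent ent' ρ c d t)
        = (ν s * ν t) * (d' s * chainMix ent ent' ρ c d t) := by ring
      _ ≤ (ν (s ∩ t) * ν (s ∪ t)) * (chainMix ent ent' ρ c d (s ∩ t) * d' (s ∪ t)) :=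
          mul_le_mul (hν s hs t ht)
            (chain_cross_holley ent ent' ρ hρ0 hρ1 c d d' hdc hcd' hdd' hd'0 s t)
            (mul_nonneg (hd'0 _) (hm0 _)) (mul_nonneg (hν0 _) (hν0 _))
      _ = _ := by ring
  have hnot : ∀ W : Finset V, W ∩ (ent ∪ ent') = ∅ → ¬ ∃ r ∈ ent ∪ ent', r ∈ W := by
    intro W hW
    rintro ⟨r, hr, hrW⟩
    have : r ∈ W ∩ (ent ∪ ent') := Finset.mem_inter.mpr ⟨hrW, hr⟩
    rw [hW] at this
    exact Finset.notMem_empty r this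
  have hI0 : ∀ W, W ∩ (ent ∪ ent') = ∅ → G₀ W = G W := by
    intro W hW
    simp only [hGdef, hG₀def]
    rw [chainMix_of_not_meet ent ent' 0 c d' (hnot W hW), chainMix_of_not_meet ent ent' ρ c d (hnot W hW)]
  have hI1 : ∀ W, W ∩ (ent ∪ ent') = ∅ → G₁ W = G W := by
    intro W hW
    simp only [hGdef, hG₁def]
    rw [chainMix_of_not_meet ent ent' 1 c d' (hnot W hW), chainMix_of_not_meet ent ent' ρ c d (hnot W hW)]
  have hρ' : (0 : R) ≤ 1 - ρ := by linarith
  have key := twoGate_functional_nonneg U (ent ∪ ent') G G₀ G₁ x y (1 - ρ) ρ hρ' hρ0 hG0 hG₀0 hG₁0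
    hx0 hy0 hxm hym wLL w00 w11 wML hI0 hI1 (by simpa only [hcomb] using hSx) hG0x
  simpa only [hcomb] using key

end LayerCakeChain

end Summit.Ventures.PercRepro2.Coin
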